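import Literature.NumberTheory.Automorphic.UnitaryCoherentGaloisRep
import Literature.NumberTheory.Automorphic.ReciprocityGLnExistenceProofs
import Literature.NumberTheory.GaloisRepresentations.GaloisRepOfAlgebraValuedLimit
import HarnessLib

/-!
# `FirstLemma` for the crux `GaloisRepGL2CMae` (item stmt-Langlands-16722), line `Sketch`

Harris–Lan–Taylor–Thorne 2016, Cor. 6.26–6.27 at `n = 2` (unramified alternative, presented CM
field `K/Fp`), as PROVABLE glue: the twisted-pair limit statement (α)₂ (HLTT §6 at `n = 2`: the
Frobenius prescription `P_v = arithFrobPolyOfSatake ι q_v 2 α_v · ∏_{b ∈ B_v}(X - b q_v^{-2N})` is,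
for every `m`, an algebra-valued `p^{-m}`-limit of base-change Satake polynomials of cuspidal
automorphic representations of `U_{K/Fp}(4)` with regular discrete series at infinity) and HLTT
Cor. 1.3 (β′) (Galois representations for such cuspidal representations of `U_{K/Fp}(2n)`) give,
through the proved `exists_semisimple_galoisRep_of_algebraValuedLimit` (Taylor 1991 §1) in rank `4`,
for every `N ≥ N₀` a continuous semisimple `R N : Γ_K → GL₄(ℚ̄_p)` unramified with
`char R N (Frob_v) = P_v` at the good places.

Stub `stub_firstLemma` of the line lead's skeleton `Lines/Sketch.lean`; both deep inputs are
HYPOTHESES of the signature (no named fact is used).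
-/

set_option linter.dupNamespace false

noncomputable section

open scoped MatrixGroups Matrix NumberField Polynomial
open NumberField IsDedekindDomain Field Polynomial Filter
open Literature.NumberTheory.Automorphic Literature.NumberTheory.GaloisRepresentations
open Literature.NumberTheory.Automorphic.HarrisLanTaylorThorne2016

namespace Summit.Langlands.Langlands.Theorems.GaloisRepGL2CMae

/-- A rational integer lies in a finite place `v` of `K` iff it lies in the prime of `ℤ` below `v`
(place bookkeeping; cf. `HarrisLanTaylorThorne2016.natCast_mem_iff_natCast_mem_under`). [folklore] -/
theorem natCast_mem_iff_mem_under {K : Type} [Field K] (v : HeightOneSpectrum (𝓞 K)) (q : ℕ) :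
    ((q : ℕ) : 𝓞 K) ∈ v.asIdeal ↔ ((q : ℕ) : ℤ) ∈ v.asIdeal.under ℤ := by
  rw [Ideal.under_def, Ideal.mem_comap, map_natCast]

/-- **First lemma** (Harris–Lan–Taylor–Thorne 2016, Cor. 6.26–6.27 at `n = 2`, unramified
alternative, presented CM field): (α)₂ → (β′) → for `N ≥ N₀` a continuous semisimple
`R N : Γ_K → GL₄(ℚ̄_p)`, unramified at the good places `v` (`v ∣ q`, `q ≠ p` unramified in `K`, `π`
unramified above `q`) with `char R N (Frob_v) = arithFrobPolyOfSatake ι q_v 2 α_v · ∏_{b ∈ B_v}(X - b q_v^{-2N})`.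
Proof: compose the two hypotheses with `exists_semisimple_galoisRep_of_algebraValuedLimit` in rank `4`.
[cite: HarrisLanTaylorThorneRMS2016, Cor. 6.26–6.27 (p. 225)] -/
theorem stub_firstLemma :
    (∀ (Fp K : Type) [Field Fp] [NumberField Fp] [Field K] [NumberField K] [Algebra Fp K]
      (cK : K ≃ₐ[Fp] K), IsTotallyReal Fp → Module.finrank Fp K = 2 → ∀ (hc : cK ≠ 1),
      IsTotallyComplex K →
      ∀ (hcpt : isCompact_glFiniteIntegralLevel 2 K) (p : ℕ) [Fact p.Prime]
        (E₀ : IntermediateField ℚ K), Module.finrank ℚ E₀ = 2 ∧ IsTotallyComplex E₀ →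
        HasTwoPrimesOver E₀ p →
      ∀ (π : CuspidalAutomorphicRepData 2 K hcpt), π.1.IsRegularAlgebraic →
      ∀ (ι : PadicAlgCl p ≃+* ℂ),
      ∃ (N₀ : ℕ) (B : HeightOneSpectrum (𝓞 K) → Multiset (PadicAlgCl p)),
        (∀ v, Multiset.card (B v) = 2 ∧ (0 : PadicAlgCl p) ∉ B v) ∧
        ∀ N, N₀ ≤ N →
          ∃ (E : IntermediateField ℚ_[p] (PadicAlgCl p)) (S : Set (HeightOneSpectrum (𝓞 K)))
            (P : HeightOneSpectrum (𝓞 K) → (PadicAlgCl p)[X]),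
            FiniteDimensional ℚ_[p] E ∧ S.Finite ∧
            (∀ v, (∃ q : ℕ, q.Prime ∧ q ≠ p ∧ ((q : ℕ) : 𝓞 K) ∈ v.asIdeal ∧
                Algebra.IsUnramifiedIn (𝓞 K) (Ideal.span {(q : ℤ)}) ∧ π.1.IsUnramifiedAbove q) →
              v ∉ S) ∧
            (∀ v ∈ S, ((p : ℕ) : 𝓞 K) ∉ v.asIdeal →
              ∀ v' : HeightOneSpectrum (𝓞 K), v'.asIdeal.under ℤ = v.asIdeal.under ℤ → v' ∈ S) ∧
            (∀ v, (∃ q : ℕ, q.Prime ∧ q ≠ p ∧ ((q : ℕ) : 𝓞 K) ∈ v.asIdeal ∧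
                Algebra.IsUnramifiedIn (𝓞 K) (Ideal.span {(q : ℤ)}) ∧ π.1.IsUnramifiedAbove q) →
              ∀ α : Multiset ℂ, π.1.HasSatakeParamAt v α →
                P v = arithFrobPolyOfSatake ι v.residueCard 2 α *
                  ((B v).map fun b ↦
                    X - C (b * ((v.residueCard : PadicAlgCl p)⁻¹) ^ (2 * N))).prod) ∧
            (∀ v ∉ S, ∀ k : ℕ, (P v).coeff k ∈ E) ∧
            ∀ m : ℕ, ∃ (r : ℕ) (hcpt4 : isCompact_glFiniteIntegralLevel 4 K)
                (σ' : Fin r → UnitaryGroup.CuspidalAutomorphicRepData Fp K cK 4 hcpt4)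
                (Q : Fin r → HeightOneSpectrum (𝓞 K) → (PadicAlgCl p)[X]) (δ : ℝ), 0 < δ ∧
              (∀ i (w : {w : InfinitePlace K // w.IsComplex}) (hw : cK • w.1 = w.1),
                  ∃ (a b : ℕ) (d : LDSDatum a b), d.IsRegular ∧
                    UnitaryGroup.IsNondegenerateLimitOfDiscreteSeriesAt Fp K cK 4
                      (StdForm.antidiagonal 4) hcpt4 (σ' i).1 hw hc d) ∧
              (∀ i, ∀ v ∉ S, ((p : ℕ) : 𝓞 K) ∉ v.asIdeal →
                  v.asIdeal.ramificationIdx ℤ = 1 ∧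
                  (∃ β, UnitaryGroup.HasBaseChangeSatakeAt Fp K cK 4 hcpt4 (σ' i).1 v β) ∧
                  ∀ β, UnitaryGroup.HasBaseChangeSatakeAt Fp K cK 4 hcpt4 (σ' i).1 v β →
                    Q i v = arithFrobPolyOfSatake ι v.residueCard 4 β) ∧
              ∀ F : MvPolynomial (HeightOneSpectrum (𝓞 K) × ℕ) ℤ,
                (∀ vk ∈ F.vars, vk.1 ∉ S ∧ ((p : ℕ) : 𝓞 K) ∉ vk.1.asIdeal) →
                (∀ i, ‖MvPolynomial.aeval
                    (fun vk : HeightOneSpectrum (𝓞 K) × ℕ => (Q i vk.1).coeff vk.2) F‖ ≤ δ) →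
                  ‖MvPolynomial.aeval
                      (fun vk : HeightOneSpectrum (𝓞 K) × ℕ => (P vk.1).coeff vk.2) F‖ ≤
                    (p : ℝ) ^ (-(m : ℤ))) →
    (∀ (Fp K : Type) [Field Fp] [NumberField Fp] [Field K] [NumberField K] [Algebra Fp K]
      (cK : K ≃ₐ[Fp] K), IsTotallyReal Fp → Module.finrank Fp K = 2 → ∀ (hc : cK ≠ 1),
      IsTotallyComplex K → ∀ (n : ℕ) (p : ℕ) [Fact p.Prime] (ι : PadicAlgCl p ≃+* ℂ)
      (E₀ : IntermediateField ℚ K), Module.finrank ℚ E₀ = 2 ∧ IsTotallyComplex E₀ →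
        HasTwoPrimesOver E₀ p →
      ∀ (hcptK : isCompact_glFiniteIntegralLevel (2 * n) K)
      (σ' : UnitaryGroup.CuspidalAutomorphicRepData Fp K cK (2 * n) hcptK),
      (∀ (w : {w : InfinitePlace K // w.IsComplex}) (hw : cK • w.1 = w.1),
        ∃ (a b : ℕ) (d : LDSDatum a b), d.IsRegular ∧
          UnitaryGroup.IsNondegenerateLimitOfDiscreteSeriesAt Fp K cK (2 * n)
            (StdForm.antidiagonal (2 * n)) hcptK σ'.1 hw hc d) →
      ∃ r : FramedGaloisRep K (PadicAlgCl p) (2 * n), r.toGaloisRep.IsSemisimple ∧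
        ∀ (u : HeightOneSpectrum (𝓞 K)) (β : Multiset ℂ), ((p : ℕ) : 𝓞 K) ∉ u.asIdeal →
          (∀ u' : HeightOneSpectrum (𝓞 K), u'.asIdeal.under ℤ = u.asIdeal.under ℤ →
            u'.asIdeal.ramificationIdx ℤ = 1 ∧
              UnitaryGroup.IsUnramifiedAt Fp K cK (2 * n) hcptK σ'.1 u') →
          UnitaryGroup.HasBaseChangeSatakeAt Fp K cK (2 * n) hcptK σ'.1 u β →
            r.IsUnramifiedAt u ∧
              r.HasFrobCharpolyAt u (arithFrobPolyOfSatake ι u.residueCard (2 * n) β)) →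
    ∀ (Fp K : Type) [Field Fp] [NumberField Fp] [Field K] [NumberField K] [Algebra Fp K]
      (cK : K ≃ₐ[Fp] K), IsTotallyReal Fp → Module.finrank Fp K = 2 → cK ≠ 1 →
      IsTotallyComplex K →
      ∀ (hcpt : isCompact_glFiniteIntegralLevel 2 K) (p : ℕ) [Fact p.Prime]
        (E₀ : IntermediateField ℚ K), Module.finrank ℚ E₀ = 2 ∧ IsTotallyComplex E₀ →
        HasTwoPrimesOver E₀ p →
      ∀ (π : CuspidalAutomorphicRepData 2 K hcpt), π.1.IsRegularAlgebraic →
      ∀ (ι : PadicAlgCl p ≃+* ℂ),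
      ∃ (N₀ : ℕ) (R : ℕ → FramedGaloisRep K (PadicAlgCl p) 4)
        (B : HeightOneSpectrum (𝓞 K) → Multiset (PadicAlgCl p)),
        (∀ N, N₀ ≤ N → (R N).toGaloisRep.IsSemisimple) ∧
        (∀ v, Multiset.card (B v) = 2 ∧ (0 : PadicAlgCl p) ∉ B v) ∧
        ∀ v, (∃ q : ℕ, q.Prime ∧ q ≠ p ∧ ((q : ℕ) : 𝓞 K) ∈ v.asIdeal ∧
            Algebra.IsUnramifiedIn (𝓞 K) (Ideal.span {(q : ℤ)}) ∧ π.1.IsUnramifiedAbove q) →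
          ∀ α : Multiset ℂ, π.1.HasSatakeParamAt v α →
          ∀ N, N₀ ≤ N → (R N).IsUnramifiedAt v ∧
            (R N).HasFrobCharpolyAt v (arithFrobPolyOfSatake ι v.residueCard 2 α *
              ((B v).map fun b ↦
                X - C (b * ((v.residueCard : PadicAlgCl p)⁻¹) ^ (2 * N))).prod) := by
  intro hα hβ Fp K _ _ _ _ _ cK hFp h2 hc hK hcpt p _ E₀ hE₀ hsplit π hπ ι
  obtain ⟨N₀, B, hB, hN⟩ := hα Fp K cK hFp h2 hc hK hcpt p E₀ hE₀ hsplit π hπ ι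
  -- Cor. 6.26 at `n = 2` for each `N ≥ N₀`: the semisimple rank-`4` representation with the
  -- prescribed Frobenius characteristic polynomials at the good places.
  have key : ∀ N, N₀ ≤ N → ∃ ρ : FramedGaloisRep K (PadicAlgCl p) 4, ρ.toGaloisRep.IsSemisimple ∧
      ∀ v, (∃ q : ℕ, q.Prime ∧ q ≠ p ∧ ((q : ℕ) : 𝓞 K) ∈ v.asIdeal ∧
          Algebra.IsUnramifiedIn (𝓞 K) (Ideal.span {(q : ℤ)}) ∧ π.1.IsUnramifiedAbove q) →
        ∀ α : Multiset ℂ, π.1.HasSatakeParamAt v α →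
          ρ.IsUnramifiedAt v ∧
            ρ.HasFrobCharpolyAt v (arithFrobPolyOfSatake ι v.residueCard 2 α *
              ((B v).map fun b ↦
                X - C (b * ((v.residueCard : PadicAlgCl p)⁻¹) ^ (2 * N))).prod) := by
    intro N hNN
    obtain ⟨E, S, P, hEfin, hSfin, hgoodS, hsat, hPgood, hPE, happrox⟩ := hN N hNN
    haveI := hEfin
    -- the algebra-valued limit theorem in rank `4`, fed with the Galois representations (β′)
    -- attached to the cuspidal approximants of (α)₂
    obtain ⟨ρ, hss, hρ⟩ : ∃ ρ : FramedGaloisRep K (PadicAlgCl p) 4, ρ.toGaloisRep.IsSemisimple ∧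
        ∀ v ∉ S, ((p : ℕ) : 𝓞 K) ∉ v.asIdeal → ρ.IsUnramifiedAt v ∧ ρ.HasFrobCharpolyAt v (P v) := by
      refine exists_semisimple_galoisRep_of_algebraValuedLimit K 4 p E hEfin S hSfin P hPE fun m ↦ ?_
      obtain ⟨r, hcpt4, σ', Q, δ, hδ, hinf, hunr, htrans⟩ := happrox m
      choose ρ' hρ'ss hρ' using fun i ↦
        hβ Fp K cK hFp h2 hc hK 2 p ι E₀ hE₀ hsplit hcpt4 (σ' i) (hinf i)
      refine ⟨r, ρ', Q, δ, hδ, fun i v hvS hpv ↦ ?_, htrans⟩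
      obtain ⟨-, ⟨β, hβv⟩, hQ⟩ := hunr i v hvS hpv
      -- every place over the rational prime below `v` is prime to `p`, hence outside `S`
      -- (saturation of `S`), hence unramified over `ℚ` with `σ' i` unramified there
      have hall : ∀ u' : HeightOneSpectrum (𝓞 K), u'.asIdeal.under ℤ = v.asIdeal.under ℤ →
          u'.asIdeal.ramificationIdx ℤ = 1 ∧
            UnitaryGroup.IsUnramifiedAt Fp K cK (2 * 2) hcpt4 (σ' i).1 u' := by
        intro u' hu'
        have hpu' : ((p : ℕ) : 𝓞 K) ∉ u'.asIdeal := fun h ↦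
          hpv ((natCast_mem_iff_mem_under v p).2 (hu' ▸ (natCast_mem_iff_mem_under u' p).1 h))
        have hu'S : u' ∉ S := fun hu'S ↦ hvS (hsat u' hu'S hpu' v hu'.symm)
        obtain ⟨he', hβ', -⟩ := hunr i u' hu'S hpu'
        exact ⟨he', hβ'⟩
      obtain ⟨hunrρ, hchar⟩ := hρ' i v β hpv hall hβv
      refine ⟨hunrρ, ?_⟩
      rw [hQ β hβv]
      exact hchar
    refine ⟨ρ, hss, fun v hgood α hαv ↦ ?_⟩
    have hvS : v ∉ S := hgoodS v hgood
    rw [← hPgood v hgood α hαv]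
    obtain ⟨q, hq, hqp, hqv, -, -⟩ := hgood
    exact hρ v hvS (natCast_not_mem_of_natCast_mem hq Fact.out hqp hqv)
  -- assemble `R` (any value below `N₀`)
  choose R hRss hR using key
  refine ⟨N₀, fun N ↦ if h : N₀ ≤ N then R N h else R N₀ le_rfl, B, fun N hN ↦ ?_, hB,
    fun v hgood α hαv N hN ↦ ?_⟩
  · simp only [dif_pos hN]
    exact hRss N hN
  · simp only [dif_pos hN]
    exact hR N hN v hgood α hαv

end Summit.Langlands.Langlands.Theorems.GaloisRepGL2CMae

end
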